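import Literature.MathematicalPhysics.QuantumFieldTheory.ConformalBootstrap3D.DimensionalReduction3D
import Literature.MathematicalPhysics.QuantumFieldTheory.ConformalBootstrap3D.DimensionalReductionSpinIdentities
import Mathlib.Tactic
import HarnessLib

/-!
# Dimensional reduction `3 → 2` of conformal blocks with spin: Hogervorst's formula at `d = 3`, all `ℓ ≥ 1`

Continuation of `DimensionalReduction3D` (engine + scalar case). For spin `ℓ ≥ 1` and `Δ > ℓ + 1` (strictly
above the `d = 3` unitarity bound, twist `τ = Δ - ℓ - 1 > 0`) we prove Hogervorst's closed form (JHEP 09 (2016)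
017, eqs. (2.24)/(2.35) "master", `ν = ½`; Pal–Qiao–Rychkov 2023 Thm A.5) for the expansion of the `d = 3` block
`g_{Δ,ℓ}` in two-dimensional global blocks `½[k_{Δ+2n+j}(z) k_{Δ+2n-j}(z̄) + (z ↔ z̄)]`, `j = ℓ, ℓ-2, …, -ℓ`, at the
level of monomial arrays (`hrMonomialCoeff_eq_spin_redArr`).

The lattice form of the closed form. With `α = (Δ-ℓ)/2`, `f_a = k_{2(α+a)}`, the block is `Σ c_{ab} f_a(z) f_b(z̄)`
over the sites `a + b = ℓ + 2n` (`n ≥ 0` the level), `x = a - n`, `y = b - n ∈ [0, ℓ]`, `x + y = ℓ`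
(`j = x - y`), and — this is eq. (2.35) at `d = 3` rewritten, using `(Δ-1)_{2n} = (Δ-1)_n (Δ-1+n)_n` and the
evenness of its `j`-dependence — the coefficient SEPARATES:

  `c_{ab} = G_n(x) G_n(y) E_n / λ_ℓ`, `G_n(x) = λ_x (α+x)_n / (α+x-½)_n`,
  `E_n = (½)_n (Δ-1)_n (β)_n (α-½)_n / (16^n n! (Δ-½)_n (β+½)_n (α)_n)`, `β = (Δ+ℓ)/2`, `λ_i = C(2i,i)/4^i`

(`spinSite`; the `1/λ_ℓ` converts Hogervorst's normalisation `c_ℓ = 1` of the leading Gegenbauer term into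
the Dolan–Osborn normalisation `k_{ℓ0} = 1` of `hrMonomialCoeff`). In these variables the odd-site relation of
the engine (`siteU`) is a four-term identity between `c` at `(n;x,y+1)`, `(n;x+1,y)`, `(n-1;x+1,y)`,
`(n-1;x,y+1)`, which after dividing by `G_{n-1}(x) G_{n-1}(y) E_{n-1}` is ONE rational identity in
`(α, n, x, y)` (`spin_interior_identity`), plus two-term identities on the edges `|a - b| = ℓ` of the band
(`spin_top_identity`) and on the level-`0` segment (`spin_legendre_identity`: `c_{ab} = λ_a λ_b/λ_ℓ` for
`a + b = ℓ`, the Fourier coefficients of the Legendre polynomial `P_ℓ(cos θ)` — the boundary condition).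
Uniqueness of the block array (`SatisfiesCoeffCasimir.eq_hrMonomialCoeff`) then identifies the sum with the
block off the accidental-degeneracy set.

Scope: `ℓ ≥ 1`, `Δ > ℓ + 1`, `¬ accidentalDegeneracy3D Δ ℓ` (the generic clause of the block predicate; the
isolated accidental points and the bound `Δ = ℓ + 1` are limits of these and are not treated here). Exact
cross-checks of every identity in rational arithmetic: pub-ising3d HOME `pub-ising3d-lit-g12/code/`.

Status in print. Hogervorst 2016 states the closed form eq. (2.35) as a conjecture ("checked … for `ℓ, n ≤ 20`");
Pal–Qiao–Rychkov 2023 restate it as "Theorem A.5 (Hogervorst)" with "the complete proof … is so far missing".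
For `d = 3` a derivation was then given by Song, Phys. Rev. Lett. 135 (2025) 211603 [arXiv:2311.05375]:
conjugating the Casimir equation by Riemann–Liouville half-derivatives in `-1/z` (`T^{1/2} k_h(z) = ρ^{h-1/2}`)
turns it into a four-term recursion for coefficients `A_{n,m}` which at `ν = ½` is separable,
`f(n,m) = g(n) - h(m)`, whence `A_{n,m} = ∏ g(p-½)/g(p) ∏ h(q-½)/h(q)` (his §1, closed form `A^{(3d)}_{n,m}`,
and §3); in the present
variables Song's `(n, m)` is (level `n`; `x = m`, `y = ℓ - m`) and `c_{ab} = A_{n,m} R_α(n+m) R_{α+ℓ}(n-m)` with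
`R_h(k) = 4^{-k} (h)_k/(h-½)_k` the change from his normalisation `k_h = 4^{1/2-h} Γ(h)/Γ(h-½) k^{DO}_{2h}`
(exact check, 230 cells: pub-ising3d HOME `pub-ising3d-lit-g12/code/song_check.py`). The proof formalised HERE is
independent of Song's and elementary (no fractional calculus, no hypergeometric transformation): nearest-neighbour
action of the `d = 3` Casimir form on products of SL(2) blocks + three rational identities + uniqueness of the
block array; it is, as far as we know, the first machine-checked proof.

References: M. Hogervorst, JHEP 09 (2016) 017 [arXiv:1604.08913] §2 eqs. (2.24), (2.35); S. Pal, J. Qiao, S. Rychkov,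
Comm. Math. Phys. 402 (2023) 2169, App. A.2 Thm A.5; C. Song, Phys. Rev. Lett. 135 (2025) 211603
[arXiv:2311.05375], §1 (`A^{(3d)}_{n,m}`) and §3; F. Dolan, H. Osborn, arXiv:1108.6194.
-/

namespace Literature.MathematicalPhysics.QuantumFieldTheory.ConformalBootstrap3D

open Finset

section Spin

/-! ### The closed form on the lattice -/

variable (Δ : ℝ) (ℓ : ℕ)

/-- `G_n(x) = λ_x (α+x)_n/(α+x-½)_n`. [cite: Hogervorst2016, §2 eqs. (2.24), (2.35)] -/
noncomputable def spinG (n x : ℕ) : ℝ :=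
  legendreLam x * (poch (halfTwist Δ ℓ + x) n / poch (halfTwist Δ ℓ + x - 1 / 2) n)

/-- `E_n = (½)_n (Δ-1)_n (β)_n (α-½)_n / (16^n n! (Δ-½)_n (β+½)_n (α)_n)`, `β = α + ℓ`.
[cite: Hogervorst2016, §2 eqs. (2.24), (2.35)] -/
noncomputable def spinE (n : ℕ) : ℝ :=
  poch (1 / 2) n * poch (Δ - 1) n * poch (halfTwist Δ ℓ + ℓ) n * poch (halfTwist Δ ℓ - 1 / 2) n /
    (16 ^ n * (n.factorial : ℝ) * poch (Δ - 1 / 2) n * poch (halfTwist Δ ℓ + ℓ + 1 / 2) n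
      * poch (halfTwist Δ ℓ) n)

/-- **Hogervorst's closed form, lattice version** (Dolan–Osborn normalisation): the site function
`c_{ab} = G_n(a-n) G_n(b-n) E_n / λ_ℓ` on the band `a + b = ℓ + 2n`, `|a - b| ≤ ℓ`, zero elsewhere.
[cite: Hogervorst2016, §2 eqs. (2.24), (2.35)] -/
noncomputable def spinSite (a b : ℕ) : ℝ :=
  if ℓ ≤ a + b ∧ (a + b + ℓ) % 2 = 0 ∧ a ≤ b + ℓ ∧ b ≤ a + ℓ then
    spinG Δ ℓ ((a + b - ℓ) / 2) (a - (a + b - ℓ) / 2) * spinG Δ ℓ ((a + b - ℓ) / 2) (b - (a + b - ℓ) / 2)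
      * spinE Δ ℓ ((a + b - ℓ) / 2) / legendreLam ℓ
  else 0

variable {Δ ℓ}

/-- Value on the band in `(n; x, y)` coordinates. [folklore] -/
theorem spinSite_val (n x y : ℕ) (hxy : x + y = ℓ) :
    spinSite Δ ℓ (n + x) (n + y) = spinG Δ ℓ n x * spinG Δ ℓ n y * spinE Δ ℓ n / legendreLam ℓ := by
  unfold spinSite
  rw [if_pos ⟨by omega, by omega, by omega, by omega⟩]
  have hn : (n + x + (n + y) - ℓ) / 2 = n := by omega
  rw [hn, Nat.add_sub_cancel_left, Nat.add_sub_cancel_left]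

/-- Zero off the band (parity). [folklore] -/
theorem spinSite_zero_of_odd {a b : ℕ} (h : (a + b + ℓ) % 2 = 1) : spinSite Δ ℓ a b = 0 := by
  unfold spinSite; rw [if_neg]; omega

/-- Zero below level `0`. [folklore] -/
theorem spinSite_zero_of_lt {a b : ℕ} (h : a + b < ℓ) : spinSite Δ ℓ a b = 0 := by
  unfold spinSite; rw [if_neg]; omega

/-- Zero outside the band `|a - b| ≤ ℓ`. [folklore] -/
theorem spinSite_zero_of_band {a b : ℕ} (h : b + ℓ < a ∨ a + ℓ < b) : spinSite Δ ℓ a b = 0 := by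
  unfold spinSite; rw [if_neg]; omega

/-- Symmetry `c_{ab} = c_{ba}`. [folklore] -/
theorem spinSite_symm (a b : ℕ) : spinSite Δ ℓ a b = spinSite Δ ℓ b a := by
  unfold spinSite
  by_cases h : ℓ ≤ a + b ∧ (a + b + ℓ) % 2 = 0 ∧ a ≤ b + ℓ ∧ b ≤ a + ℓ
  · rw [if_pos h, if_pos ⟨by omega, by omega, by omega, by omega⟩, Nat.add_comm b a]
    ring
  · rw [if_neg h, if_neg (by omega)]

/-- Row `b = 0`: only the corner `a = ℓ` is on the band. [folklore] -/
theorem spinSite_row_zero (a : ℕ) (ha : a ≠ ℓ) : spinSite Δ ℓ a 0 = 0 := by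
  unfold spinSite; rw [if_neg]; omega

/-- The corner: `c_{ℓ0} = 1` (Dolan–Osborn normalisation `k_{ℓ0} = 1`). [folklore] -/
theorem spinSite_corner : spinSite Δ ℓ ℓ 0 = 1 := by
  have h := spinSite_val (Δ := Δ) (ℓ := ℓ) 0 ℓ 0 (by omega)
  simp only [zero_add, add_zero] at h
  rw [h]
  unfold spinG spinE
  simp [legendreLam_ne_zero ℓ]

/-- `G_n(x) > 0` strictly above the unitarity bound (`α > ½`). [folklore] -/
theorem spinG_pos (hα : 1 / 2 < halfTwist Δ ℓ) (n x : ℕ) : 0 < spinG Δ ℓ n x := by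
  unfold spinG
  have hx : (0 : ℝ) ≤ x := Nat.cast_nonneg x
  have h0 := legendreLam_pos x
  have h1 := poch_pos (show (0 : ℝ) < halfTwist Δ ℓ + x by linarith) n
  have h2 := poch_pos (show (0 : ℝ) < halfTwist Δ ℓ + x - 1 / 2 by linarith) n
  positivity

/-- `E_n > 0` for `Δ > ℓ + 1`. [folklore] -/
theorem spinE_pos (hΔ : (ℓ : ℝ) + 1 < Δ) (n : ℕ) : 0 < spinE Δ ℓ n := by
  unfold spinE
  have hl : (0 : ℝ) ≤ ℓ := Nat.cast_nonneg ℓ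
  have hα : 1 / 2 < halfTwist Δ ℓ := by unfold halfTwist; linarith
  have h1 := poch_pos (by norm_num : (0 : ℝ) < 1 / 2) n
  have h2 := poch_pos (show (0 : ℝ) < Δ - 1 by linarith) n
  have h3 := poch_pos (show (0 : ℝ) < halfTwist Δ ℓ + ℓ by linarith) n
  have h4 := poch_pos (show (0 : ℝ) < halfTwist Δ ℓ - 1 / 2 by linarith) n
  have h5 := poch_pos (show (0 : ℝ) < Δ - 1 / 2 by linarith) n
  have h6 := poch_pos (show (0 : ℝ) < halfTwist Δ ℓ + ℓ + 1 / 2 by linarith) n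
  have h7 := poch_pos (show (0 : ℝ) < halfTwist Δ ℓ by linarith) n
  positivity

/-- **Positivity of Hogervorst's coefficients** above the unitarity bound: `c_{ab} ≥ 0` for `Δ > ℓ + 1`
(strictly positive on the band). This is the manifest positivity of eq. (2.35) at unitary `(Δ, ℓ)`, `d = 3`.
[cite: Hogervorst2016, §2 eqs. (2.24), (2.35)] -/
theorem spinSite_nonneg (hΔ : (ℓ : ℝ) + 1 < Δ) (a b : ℕ) : 0 ≤ spinSite Δ ℓ a b := by
  have hα : 1 / 2 < halfTwist Δ ℓ := by unfold halfTwist; linarith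
  unfold spinSite
  split_ifs with h
  · have h1 := spinG_pos hα ((a + b - ℓ) / 2) (a - (a + b - ℓ) / 2)
    have h2 := spinG_pos hα ((a + b - ℓ) / 2) (b - (a + b - ℓ) / 2)
    have h3 := spinE_pos hΔ ((a + b - ℓ) / 2)
    have h4 := legendreLam_pos ℓ
    positivity
  · exact le_rfl

/-- On the band the coefficient is strictly positive. [cite: Hogervorst2016, §2 eqs. (2.24), (2.35)] -/
theorem spinSite_val_pos (hΔ : (ℓ : ℝ) + 1 < Δ) (n x y : ℕ) (hxy : x + y = ℓ) :
    0 < spinSite Δ ℓ (n + x) (n + y) := by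
  have hα : 1 / 2 < halfTwist Δ ℓ := by unfold halfTwist; linarith
  rw [spinSite_val n x y hxy]
  have h1 := spinG_pos hα n x
  have h2 := spinG_pos hα n y
  have h3 := spinE_pos hΔ n
  have h4 := legendreLam_pos ℓ
  positivity

/-! ### Step lemmas -/

/-- `Δ = 2α + ℓ`. [folklore] -/
theorem two_halfTwist_add (Δ : ℝ) (ℓ : ℕ) : Δ = 2 * halfTwist Δ ℓ + ℓ := by
  unfold halfTwist; ring

/-- `μ` of the engine is `spinMu` at `h_a = α + a`, `h_b = α + b`. [folklore] -/
theorem siteMu_eq_spinMu (a b : ℕ) :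
    siteMu Δ ℓ a b = spinMu (halfTwist Δ ℓ) ℓ (halfTwist Δ ℓ + a) (halfTwist Δ ℓ + b) := by
  unfold siteMu siteWeight spinMu casimirEigenvalue3D halfTwist
  ring

/-- `(B) (B+1)_m = (B)_m (B+m)`. [folklore] -/
private theorem poch_shift (B : ℝ) (m : ℕ) : B * poch (B + 1) m = poch B m * (B + m) := by
  rw [← poch_succ_left, poch_succ]

/-- `x`-step: `G_m(x+1) = G_m(x) · r`. [folklore] -/
theorem spinG_succ_x (hα : 1 / 2 < halfTwist Δ ℓ) (m x : ℕ) :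
    spinG Δ ℓ m (x + 1) = spinG Δ ℓ m x * spinR (halfTwist Δ ℓ) m x := by
  unfold spinG spinR
  rw [legendreLam_succ]
  push_cast
  have e1 : halfTwist Δ ℓ + ((x : ℝ) + 1) = (halfTwist Δ ℓ + x) + 1 := by ring
  have e2 : halfTwist Δ ℓ + x + 1 - 1 / 2 = (halfTwist Δ ℓ + x - 1 / 2) + 1 := by ring
  rw [e1, e2]
  have hA := poch_shift (halfTwist Δ ℓ + x) m
  have hB := poch_shift (halfTwist Δ ℓ + x - 1 / 2) m
  generalize eP : poch (halfTwist Δ ℓ + x + 1) m = P at hA ⊢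
  generalize eP' : poch (halfTwist Δ ℓ + x - 1 / 2 + 1) m = P' at hB ⊢
  generalize eQ : poch (halfTwist Δ ℓ + x) m = Q at hA ⊢
  generalize eQ' : poch (halfTwist Δ ℓ + x - 1 / 2) m = Q' at hB ⊢
  have hQ' : Q' ≠ 0 := by rw [← eQ']; exact poch_ne_zero (by linarith) m
  have hP' : P' ≠ 0 := by rw [← eP']; exact poch_ne_zero (by linarith) m
  generalize eb2 : halfTwist Δ ℓ + (x : ℝ) - 1 / 2 + m = b2 at hB ⊢
  generalize eb1 : halfTwist Δ ℓ + (x : ℝ) - 1 / 2 = b1 at hB ⊢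
  generalize ea1 : halfTwist Δ ℓ + (x : ℝ) = a1 at hA ⊢
  generalize ed : 2 * (x : ℝ) + 2 = d
  have fb2 : b2 ≠ 0 := by rw [← eb2]; intro h; linarith
  have fb1 : b1 ≠ 0 := by rw [← eb1]; intro h; linarith
  have fa1 : a1 ≠ 0 := by rw [← ea1]; intro h; linarith
  have fd : d ≠ 0 := by rw [← ed]; positivity
  -- solve the shift relations for `P`, `P'`
  have hP : P = Q * (a1 + m) / a1 := by rw [eq_div_iff fa1]; linear_combination hA
  have hP'' : P' = Q' * b2 / b1 := by rw [eq_div_iff fb1]; linear_combination hB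
  rw [hP, hP'']
  field_simp

/-- level-step: `G_{m+1}(x) = G_m(x) · s`. [folklore] -/
theorem spinG_succ_level (m x : ℕ) :
    spinG Δ ℓ (m + 1) x = spinG Δ ℓ m x * spinS (halfTwist Δ ℓ) m x := by
  unfold spinG spinS
  rw [poch_succ, poch_succ, mul_assoc, div_mul_div_comm]

/-- level-step for `E`: `E_{m+1} = E_m · e`. [folklore] -/
theorem spinE_succ (hα : 1 / 2 < halfTwist Δ ℓ) (m : ℕ) :
    spinE Δ ℓ (m + 1) = spinE Δ ℓ m * spinEr (halfTwist Δ ℓ) m ℓ := by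
  unfold spinE spinEr
  rw [poch_succ, poch_succ, poch_succ, poch_succ, poch_succ, poch_succ, poch_succ, pow_succ,
    Nat.factorial_succ]
  push_cast
  have hΔ := two_halfTwist_add Δ ℓ
  generalize eal : halfTwist Δ ℓ = al at hΔ hα ⊢
  subst hΔ
  generalize eP1 : poch (1 / 2) m = P1
  generalize eP2 : poch (2 * al + ℓ - 1) m = P2
  generalize eP3 : poch (al + ℓ) m = P3
  generalize eP4 : poch (al - 1 / 2) m = P4
  generalize eP5 : poch (2 * al + ℓ - 1 / 2) m = P5
  generalize eP6 : poch (al + ℓ + 1 / 2) m = P6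
  generalize eP7 : poch al m = P7
  have hl0 : (0 : ℝ) ≤ ℓ := Nat.cast_nonneg ℓ
  have f5 : P5 ≠ 0 := by rw [← eP5]; exact poch_ne_zero (by linarith) m
  have f6 : P6 ≠ 0 := by rw [← eP6]; exact poch_ne_zero (by linarith) m
  have f7 : P7 ≠ 0 := by rw [← eP7]; exact poch_ne_zero (by linarith) m
  generalize ed1 : 2 * al + (ℓ : ℝ) - 1 / 2 + m = d1
  generalize ed2 : al + (ℓ : ℝ) + 1 / 2 + m = d2
  generalize ed3 : al + (m : ℝ) = d3
  generalize ed4 : (m : ℝ) + 1 = d4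
  have g1 : d1 ≠ 0 := by rw [← ed1]; intro h; linarith
  have g2 : d2 ≠ 0 := by rw [← ed2]; intro h; linarith
  have g3 : d3 ≠ 0 := by rw [← ed3]; intro h; linarith
  have g4 : d4 ≠ 0 := by rw [← ed4]; intro h; linarith
  have f0 : (m.factorial : ℝ) ≠ 0 := by positivity
  have f8 : (16 : ℝ) ^ m ≠ 0 := by positivity
  field_simp

/-! ### The odd-site relation for the closed form -/

/-- Uniform formula for `U_{a,b+1}` (the `b = 0` slot uses `μ_{ℓ0} = α` and `(2α-1)γ_α = γ'_α`). [folklore] -/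
theorem siteU_succ_eq (c : ℕ → ℕ → ℝ) (hc0 : ∀ a, a ≠ ℓ → c a 0 = 0) (hτ : 2 * halfTwist Δ ℓ - 1 ≠ 0)
    (a b : ℕ) :
    siteU Δ ℓ c a (b + 1) = c a (b + 2) * (siteMu Δ ℓ a (b + 2) - siteWeight Δ ℓ (b + 2))
      + c a (b + 1) * siteMu Δ ℓ a (b + 1) / 2
      + c a b * (siteMu Δ ℓ a b + siteWeight Δ ℓ b - 1) * sl2Gamma (siteWeight Δ ℓ b) := by
  unfold siteU
  cases b with
  | zero =>
    rw [zero_add, siteW_one]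
    by_cases ha : a = ℓ
    · subst ha
      rw [siteMu_ell_zero]
      unfold siteWeight
      push_cast
      rw [add_zero, ← sl2Gamma'_eq hτ]
      ring
    · rw [hc0 a ha]; ring
  | succ b =>
    rw [show b + 1 + 1 = b + 2 from rfl, siteW_add_two]

/-- `U_{a,0}`. [folklore] -/
theorem siteU_zero_eq (c : ℕ → ℕ → ℝ) (a : ℕ) :
    siteU Δ ℓ c a 0 = c a 1 * (siteMu Δ ℓ a 1 - siteWeight Δ ℓ 1) + c a 0 * siteMu Δ ℓ a 0 / 2 := by
  unfold siteU; rw [siteW_zero]; ring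

/-- `h_a = α + a`. [folklore] -/
theorem siteWeight_eq (a : ℕ) : siteWeight Δ ℓ a = halfTwist Δ ℓ + a := rfl

/-- **Interior odd sites** `(a,b) = (m+1+x, m+1+y)`, `x + y + 1 = ℓ`. [folklore] -/
theorem spin_U_interior (hα : 1 / 2 < halfTwist Δ ℓ) (m x y : ℕ) (hℓ : x + y + 1 = ℓ) :
    siteU Δ ℓ (spinSite Δ ℓ) (m + 1 + x) (m + 1 + y) = siteU Δ ℓ (spinSite Δ ℓ) (m + 1 + y) (m + 1 + x) := by
  have hτ : 2 * halfTwist Δ ℓ - 1 ≠ 0 := by intro h; linarith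
  have hc0 : ∀ a, a ≠ ℓ → spinSite Δ ℓ a 0 = 0 := fun a ha => spinSite_row_zero a ha
  rw [show m + 1 + y = (m + y) + 1 by ring, show m + 1 + x = (m + x) + 1 by ring,
    siteU_succ_eq _ hc0 hτ, siteU_succ_eq _ hc0 hτ]
  -- the six site values
  have c1 : spinSite Δ ℓ (m + x + 1) (m + y + 2) = spinG Δ ℓ (m + 1) x * spinG Δ ℓ (m + 1) (y + 1)
      * spinE Δ ℓ (m + 1) / legendreLam ℓ := by
    rw [show m + x + 1 = (m + 1) + x by ring, show m + y + 2 = (m + 1) + (y + 1) by ring]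
    exact spinSite_val (m + 1) x (y + 1) (by omega)
  have c0 : spinSite Δ ℓ (m + x + 1) (m + y + 1) = 0 := spinSite_zero_of_odd (by omega)
  have c3 : spinSite Δ ℓ (m + x + 1) (m + y) = spinG Δ ℓ m (x + 1) * spinG Δ ℓ m y * spinE Δ ℓ m
      / legendreLam ℓ := by
    rw [show m + x + 1 = m + (x + 1) by ring]
    exact spinSite_val m (x + 1) y (by omega)
  have c2 : spinSite Δ ℓ (m + y + 1) (m + x + 2) = spinG Δ ℓ (m + 1) (x + 1) * spinG Δ ℓ (m + 1) y
      * spinE Δ ℓ (m + 1) / legendreLam ℓ := by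
    rw [spinSite_symm, show m + x + 2 = (m + 1) + (x + 1) by ring, show m + y + 1 = (m + 1) + y by ring]
    exact spinSite_val (m + 1) (x + 1) y (by omega)
  have c0' : spinSite Δ ℓ (m + y + 1) (m + x + 1) = 0 := spinSite_zero_of_odd (by omega)
  have c4 : spinSite Δ ℓ (m + y + 1) (m + x) = spinG Δ ℓ m x * spinG Δ ℓ m (y + 1) * spinE Δ ℓ m
      / legendreLam ℓ := by
    rw [spinSite_symm, show m + y + 1 = m + (y + 1) by ring]
    exact spinSite_val m x (y + 1) (by omega)
  rw [c1, c0, c3, c2, c0', c4]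
  rw [spinG_succ_level m x, spinG_succ_level m (y + 1), spinG_succ_x hα m y, spinE_succ hα m,
    spinG_succ_level m (x + 1), spinG_succ_x hα m x, spinG_succ_level m y]
  simp only [siteMu_eq_spinMu, siteWeight_eq]
  have key := spin_interior_identity (halfTwist Δ ℓ) m x y hα (Nat.cast_nonneg m) (Nat.cast_nonneg x)
    (Nat.cast_nonneg y)
  have hm0 : (0 : ℝ) ≤ m := Nat.cast_nonneg m
  have hx0 : (0 : ℝ) ≤ x := Nat.cast_nonneg x
  have hy0 : (0 : ℝ) ≤ y := Nat.cast_nonneg y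
  subst hℓ
  push_cast at key ⊢
  rw [spinS_eq_RA (halfTwist Δ (x + y + 1)) m x hα hm0 hx0, spinS_eq_RA (halfTwist Δ (x + y + 1)) m y hα hm0 hy0,
    sl2Gamma_eq_RB (halfTwist Δ (x + y + 1)) m y hα hm0 hy0, sl2Gamma_eq_RB (halfTwist Δ (x + y + 1)) m x hα hm0 hx0]
  unfold spinMu at key ⊢
  linear_combination (spinG Δ (x + y + 1) m x * spinG Δ (x + y + 1) m y * spinE Δ (x + y + 1) m /
    legendreLam (x + y + 1) * spinR (halfTwist Δ (x + y + 1)) m x * spinR (halfTwist Δ (x + y + 1)) m y) * key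

/-- **Top-edge odd sites** `(a,b) = (m+1+ℓ, m)`. [folklore] -/
theorem spin_U_top (hα : 1 / 2 < halfTwist Δ ℓ) (m : ℕ) :
    siteU Δ ℓ (spinSite Δ ℓ) (m + 1 + ℓ) m = siteU Δ ℓ (spinSite Δ ℓ) m (m + 1 + ℓ) := by
  have hτ : 2 * halfTwist Δ ℓ - 1 ≠ 0 := by intro h; linarith
  have hc0 : ∀ a, a ≠ ℓ → spinSite Δ ℓ a 0 = 0 := fun a ha => spinSite_row_zero a ha
  -- right-hand side: second index `m + 1 + ℓ = (m + ℓ) + 1`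
  rw [show m + 1 + ℓ = (m + ℓ) + 1 by ring, siteU_succ_eq _ hc0 hτ m (m + ℓ)]
  have r1 : spinSite Δ ℓ m (m + ℓ + 2) = 0 := spinSite_zero_of_band (by omega)
  have r2 : spinSite Δ ℓ m (m + ℓ + 1) = 0 := spinSite_zero_of_band (by omega)
  have r3 : spinSite Δ ℓ m (m + ℓ) = spinG Δ ℓ m 0 * spinG Δ ℓ m ℓ * spinE Δ ℓ m / legendreLam ℓ := by
    have := spinSite_val (Δ := Δ) (ℓ := ℓ) m 0 ℓ (by omega)
    rwa [add_zero] at this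
  rw [r1, r2, r3]
  -- left-hand side: second index `m`, which may be `0`
  have l1 : spinSite Δ ℓ (m + ℓ + 1) (m + 1) = spinG Δ ℓ (m + 1) ℓ * spinG Δ ℓ (m + 1) 0 * spinE Δ ℓ (m + 1)
      / legendreLam ℓ := by
    have := spinSite_val (Δ := Δ) (ℓ := ℓ) (m + 1) ℓ 0 (by omega)
    rwa [add_zero, show m + 1 + ℓ = m + ℓ + 1 by ring] at this
  have l0 : spinSite Δ ℓ (m + ℓ + 1) m = 0 := spinSite_zero_of_band (by omega)
  have key := spin_top_identity (halfTwist Δ ℓ) m ℓ hα (Nat.cast_nonneg m) (Nat.cast_nonneg ℓ)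
  cases m with
  | zero =>
    rw [siteU_zero_eq]
    simp only [zero_add] at l1 l0 r3 key ⊢
    rw [l1, l0, spinG_succ_level 0 ℓ, spinG_succ_level 0 0, spinE_succ hα 0]
    simp only [siteMu_eq_spinMu, siteWeight_eq]
    push_cast at key ⊢
    unfold spinMu sl2Gamma at key ⊢
    linear_combination (spinG Δ ℓ 0 0 * spinG Δ ℓ 0 ℓ * spinE Δ ℓ 0 / legendreLam ℓ) * key
  | succ m =>
    rw [siteU_succ_eq _ hc0 hτ]
    have l2 : spinSite Δ ℓ (m + 1 + ℓ + 1) (m + 2) = spinG Δ ℓ (m + 2) ℓ * spinG Δ ℓ (m + 2) 0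
        * spinE Δ ℓ (m + 2) / legendreLam ℓ := by
      rwa [show m + 1 + 1 = m + 2 by ring] at l1
    have l3 : spinSite Δ ℓ (m + 1 + ℓ + 1) m = 0 := spinSite_zero_of_band (by omega)
    rw [l2, l0, l3, show m + 2 = (m + 1) + 1 by ring, spinG_succ_level (m + 1) ℓ,
      spinG_succ_level (m + 1) 0, spinE_succ hα (m + 1)]
    simp only [siteMu_eq_spinMu, siteWeight_eq]
    push_cast at key ⊢
    unfold spinMu sl2Gamma at key ⊢
    linear_combination (spinG Δ ℓ (m + 1) 0 * spinG Δ ℓ (m + 1) ℓ * spinE Δ ℓ (m + 1) / legendreLam ℓ) * key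

/-- **Level-`0` odd sites** `(a,b) = (x, y)`, `x + y + 1 = ℓ`. [folklore] -/
theorem spin_U_legendre (hα : 1 / 2 < halfTwist Δ ℓ) (x y : ℕ) (hℓ : x + y + 1 = ℓ) :
    siteU Δ ℓ (spinSite Δ ℓ) x y = siteU Δ ℓ (spinSite Δ ℓ) y x := by
  have hτ : 2 * halfTwist Δ ℓ - 1 ≠ 0 := by intro h; linarith
  have hc0 : ∀ a, a ≠ ℓ → spinSite Δ ℓ a 0 = 0 := fun a ha => spinSite_row_zero a ha
  have v1 : spinSite Δ ℓ x (y + 1) = legendreLam x * legendreLam (y + 1) / legendreLam ℓ := by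
    have := spinSite_val (Δ := Δ) (ℓ := ℓ) 0 x (y + 1) (by omega)
    simp only [zero_add] at this
    rw [this]; unfold spinG spinE; simp
  have v2 : spinSite Δ ℓ y (x + 1) = legendreLam (x + 1) * legendreLam y / legendreLam ℓ := by
    have := spinSite_val (Δ := Δ) (ℓ := ℓ) 0 (x + 1) y (by omega)
    simp only [zero_add] at this
    rw [spinSite_symm, this]; unfold spinG spinE; simp
  have v0 : spinSite Δ ℓ x y = 0 := spinSite_zero_of_lt (by omega)
  have v0' : spinSite Δ ℓ y x = 0 := spinSite_zero_of_lt (by omega)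
  have key := spin_legendre_identity (halfTwist Δ ℓ) x y
  -- the lower neighbours are below level 0
  have hU : ∀ (p q : ℕ), p + q + 1 = ℓ → siteU Δ ℓ (spinSite Δ ℓ) p q =
      spinSite Δ ℓ p (q + 1) * (siteMu Δ ℓ p (q + 1) - siteWeight Δ ℓ (q + 1)) := by
    intro p q hpq
    cases q with
    | zero => rw [siteU_zero_eq, spinSite_zero_of_lt (a := p) (b := 0) (by omega)]; ring
    | succ q =>
      rw [siteU_succ_eq _ hc0 hτ, spinSite_zero_of_lt (a := p) (b := q + 1) (by omega),
        spinSite_zero_of_lt (a := p) (b := q) (by omega)]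
      ring
  rw [hU x y hℓ, hU y x (by omega), v1, v2]
  simp only [siteMu_eq_spinMu, siteWeight_eq]
  have eℓ : (ℓ : ℝ) = x + y + 1 := by rw [← hℓ]; push_cast; ring
  rw [eℓ]
  push_cast at key ⊢
  unfold spinMu at key ⊢
  linear_combination (1 / legendreLam ℓ) * key

/-- **The odd-site relation for Hogervorst's closed form**, all sites. [folklore] -/
theorem spinSite_U_symm (hα : 1 / 2 < halfTwist Δ ℓ) (a b : ℕ) :
    siteU Δ ℓ (spinSite Δ ℓ) a b = siteU Δ ℓ (spinSite Δ ℓ) b a := by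
  have hτ : 2 * halfTwist Δ ℓ - 1 ≠ 0 := by intro h; linarith
  have hc0 : ∀ a, a ≠ ℓ → spinSite Δ ℓ a 0 = 0 := fun a ha => spinSite_row_zero a ha
  -- generic shape of `U` with all three sites named
  have shape : ∀ p q : ℕ, siteU Δ ℓ (spinSite Δ ℓ) p q =
      spinSite Δ ℓ p (q + 1) * (siteMu Δ ℓ p (q + 1) - siteWeight Δ ℓ (q + 1))
      + spinSite Δ ℓ p q * siteMu Δ ℓ p q / 2
      + (if 1 ≤ q then spinSite Δ ℓ p (q - 1) * (siteMu Δ ℓ p (q - 1) + siteWeight Δ ℓ (q - 1) - 1)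
          * sl2Gamma (siteWeight Δ ℓ (q - 1)) else 0) := by
    intro p q
    cases q with
    | zero => rw [siteU_zero_eq]; simp
    | succ q => rw [siteU_succ_eq _ hc0 hτ]; simp
  rcases Nat.lt_or_ge (a + b + 1) ℓ with hlow | hge
  · -- everything below level 0
    rw [shape, shape]
    have z : ∀ p q : ℕ, p + q ≤ a + b + 1 → spinSite Δ ℓ p q = 0 := fun p q h => spinSite_zero_of_lt (by omega)
    rw [z a (b + 1) (by omega), z a b (by omega), z b (a + 1) (by omega), z b a (by omega)]
    split_ifs with h1 h2 h2
    · rw [z a (b - 1) (by omega), z b (a - 1) (by omega)]; ring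
    · rw [z a (b - 1) (by omega)]; ring
    · rw [z b (a - 1) (by omega)]; ring
    · ring
  rcases Nat.even_or_odd (a + b + ℓ) with hev | hodd
  · -- even site: only the `μ/2` terms survive, and they agree
    rw [shape, shape, spinSite_zero_of_odd (a := a) (b := b + 1) (by rcases hev with ⟨k, hk⟩; omega),
      spinSite_zero_of_odd (a := b) (b := a + 1) (by rcases hev with ⟨k, hk⟩; omega), spinSite_symm b a,
      siteMu_comm b a]
    split_ifs with h1 h2 h2
    · rw [spinSite_zero_of_odd (a := a) (b := b - 1) (by rcases hev with ⟨k, hk⟩; omega),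
        spinSite_zero_of_odd (a := b) (b := a - 1) (by rcases hev with ⟨k, hk⟩; omega)]; ring
    · rw [spinSite_zero_of_odd (a := a) (b := b - 1) (by rcases hev with ⟨k, hk⟩; omega)]; ring
    · rw [spinSite_zero_of_odd (a := b) (b := a - 1) (by rcases hev with ⟨k, hk⟩; omega)]; ring
    · ring
  -- odd site at level `n ≥ 0`: `a + b + 1 = ℓ + 2n`
  obtain ⟨n, hn⟩ : ∃ n, a + b + 1 = ℓ + 2 * n := by rcases hodd with ⟨k, hk⟩; exact ⟨(a + b + 1 - ℓ) / 2, by omega⟩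
  rcases Nat.eq_zero_or_pos n with rfl | hnpos
  · -- level 0: the Legendre edge
    exact spin_U_legendre hα a b (by omega)
  obtain ⟨m, rfl⟩ : ∃ m, n = m + 1 := ⟨n - 1, by omega⟩
  -- position across the band: `p = b + 1 - n`
  rcases Nat.lt_or_ge (b + 1) (m + 1) with hb | hb
  · -- `b + 1 < n`: then `a > b + ℓ + 1`, all four sites off the band
    rw [shape, shape]
    have z1 : spinSite Δ ℓ a (b + 1) = 0 := spinSite_zero_of_band (by omega)
    have z2 : spinSite Δ ℓ a b = 0 := spinSite_zero_of_band (by omega)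
    have z3 : spinSite Δ ℓ b (a + 1) = 0 := spinSite_zero_of_band (by omega)
    have z4 : spinSite Δ ℓ b a = 0 := spinSite_zero_of_band (by omega)
    rw [z1, z2, z3, z4]
    split_ifs with h1 h2 h2
    · rw [spinSite_zero_of_band (a := a) (b := b - 1) (by omega),
        spinSite_zero_of_band (a := b) (b := a - 1) (by omega)]; ring
    · rw [spinSite_zero_of_band (a := a) (b := b - 1) (by omega)]; ring
    · rw [spinSite_zero_of_band (a := b) (b := a - 1) (by omega)]; ring
    · ring
  -- `p = b + 1 - n ≥ 0`
  obtain ⟨p, hp⟩ : ∃ p, b + 1 = (m + 1) + p := ⟨b + 1 - (m + 1), by omega⟩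
  rcases Nat.eq_zero_or_pos p with rfl | hppos
  · -- top edge `p = 0`: `(a,b) = (m+1+ℓ, m)`
    rw [show a = m + 1 + ℓ by omega, show b = m by omega]
    exact spin_U_top hα m
  rcases Nat.lt_or_ge p (ℓ + 1) with hpl | hpl
  · -- interior `1 ≤ p ≤ ℓ`: `x = ℓ - p`, `y = p - 1`
    obtain ⟨y, rfl⟩ : ∃ y, p = y + 1 := ⟨p - 1, by omega⟩
    obtain ⟨x, hx⟩ : ∃ x, x + y + 1 = ℓ := ⟨ℓ - y - 1, by omega⟩
    rw [show a = m + 1 + x by omega, show b = m + 1 + y by omega]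
    exact spin_U_interior hα m x y hx
  rcases Nat.lt_or_ge p (ℓ + 2) with hpl2 | hpl2
  · -- mirror edge `p = ℓ + 1`: `(a,b) = (m, m+1+ℓ)`
    rw [show a = m by omega, show b = m + 1 + ℓ by omega]
    exact (spin_U_top hα m).symm
  · -- beyond the mirror edge: all four sites off the band
    rw [shape, shape]
    have z1 : spinSite Δ ℓ a (b + 1) = 0 := spinSite_zero_of_band (by omega)
    have z2 : spinSite Δ ℓ a b = 0 := spinSite_zero_of_band (by omega)
    have z3 : spinSite Δ ℓ b (a + 1) = 0 := spinSite_zero_of_band (by omega)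
    have z4 : spinSite Δ ℓ b a = 0 := spinSite_zero_of_band (by omega)
    rw [z1, z2, z3, z4]
    split_ifs with h1 h2 h2
    · rw [spinSite_zero_of_band (a := a) (b := b - 1) (by omega),
        spinSite_zero_of_band (a := b) (b := a - 1) (by omega)]; ring
    · rw [spinSite_zero_of_band (a := a) (b := b - 1) (by omega)]; ring
    · rw [spinSite_zero_of_band (a := b) (b := a - 1) (by omega)]; ring
    · ring

/-! ### The theorem -/

/-- **Dimensional reduction with spin, coefficient level.** For `ℓ ≥ 1` and `Δ > ℓ + 1` the array of
`Σ_{a,b} c_{ab} k_{2(α+a)}(z) k_{2(α+b)}(z̄)` with Hogervorst's closed-form `c` (`spinSite`) satisfies the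
three-dimensional coefficient Casimir system of the spin-`ℓ` block, is symmetric, and has the Dolan–Osborn
leading part. [cite: Hogervorst2016, §2 eqs. (2.24), (2.35)] -/
theorem spin_redArr_satisfies {ℓ : ℕ} (hΔ : (ℓ : ℝ) + 1 < Δ) :
    SatisfiesCoeffCasimir 0 0 Δ ℓ (redArr Δ ℓ (spinSite Δ ℓ)) ∧
      (∀ p : ℕ × ℕ, redArr Δ ℓ (spinSite Δ ℓ) (p.2, p.1) = redArr Δ ℓ (spinSite Δ ℓ) p) ∧
      HasLeadingPart ℓ (redArr Δ ℓ (spinSite Δ ℓ)) := by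
  have hα : 1 / 2 < halfTwist Δ ℓ := by unfold halfTwist; linarith
  have hα0 : 0 < halfTwist Δ ℓ := by linarith
  exact ⟨redArr_satisfiesCoeffCasimir hα0 _ spinSite_symm (fun a ha => spinSite_row_zero a ha)
      (spinSite_U_symm hα), redArr_symm _ spinSite_symm,
    redArr_hasLeadingPart _ (fun a ha => spinSite_row_zero a ha) spinSite_corner⟩

/-- **Hogervorst's dimensional reduction at `d = 3`, spin `ℓ ≥ 1`, coefficient level.** For `Δ > ℓ + 1`
off the accidental-degeneracy set, the monomial array of the `d = 3` block `g_{Δ,ℓ}` (Dolan–Osborn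
normalisation, `hrMonomialCoeff Δ ℓ`) IS the array of `Σ_{a,b} c_{ab} k_{2(α+a)}(z) k_{2(α+b)}(z̄)` with
`c` Hogervorst's closed form eq. (2.35) in lattice variables (`spinSite`): i.e. `g^{(3)}_{Δ,ℓ} = Σ_{n,j}
𝒜_{n,j}(Δ,ℓ) G^{(2)}_{Δ+2n,j}` coefficient by coefficient. In print: conjectured by Hogervorst 2016 (checked to
`ℓ, n ≤ 20`); "Theorem A.5 (Hogervorst)" of Pal–Qiao–Rychkov 2023 ("proof … so far missing"); derived for `d = 3`
by Song 2025 via half-derivative conjugation of the Casimir equation (his `A^{(3d)}_{n,m}`, §1, equals `c_{ab}` up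
to the normalisation of `k`, see the module docstring). The proof here is independent and elementary.
[cite: Hogervorst2016, §2 eqs. (2.24), (2.35)] [cite: PalQiaoRychkov2023, App. A.2 Thm A.5] [cite: Song2025, §1, §3] -/
theorem hrMonomialCoeff_eq_spin_redArr {ℓ : ℕ} (hℓ : 1 ≤ ℓ) (hΔ : (ℓ : ℝ) + 1 < Δ)
    (hreg : ¬ accidentalDegeneracy3D Δ ℓ) :
    hrMonomialCoeff Δ ℓ = redArr Δ ℓ (spinSite Δ ℓ) := by
  obtain ⟨h1, h2, h3⟩ := spin_redArr_satisfies hΔ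
  have hb : unitarityBound3D ℓ < Δ := by
    unfold unitarityBound3D; rw [if_neg (by omega)]; exact hΔ
  exact (h1.eq_hrMonomialCoeff hb hreg h2 h3).symm

/-- The same, entrywise: `k^{HR}_{PQ}(Δ,ℓ) = Σ_{a ≤ P} Σ_{b ≤ Q} c_{ab} κ_{α+a}(P-a) κ_{α+b}(Q-b)`.
[cite: Hogervorst2016, §2 eqs. (2.24), (2.35)] -/
theorem hrMonomialCoeff_spin_apply {ℓ : ℕ} (hℓ : 1 ≤ ℓ) (hΔ : (ℓ : ℝ) + 1 < Δ)
    (hreg : ¬ accidentalDegeneracy3D Δ ℓ) (P Q : ℕ) :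
    hrMonomialCoeff Δ ℓ (P, Q) =
      ∑ a ∈ range (P + 1), ∑ b ∈ range (Q + 1), spinSite Δ ℓ a b *
        sl2CoeffZ (halfTwist Δ ℓ + a) ((P : ℤ) - a) * sl2CoeffZ (halfTwist Δ ℓ + b) ((Q : ℤ) - b) := by
  rw [hrMonomialCoeff_eq_spin_redArr hℓ hΔ hreg]
  rfl

end Spin

end Literature.MathematicalPhysics.QuantumFieldTheory.ConformalBootstrap3D
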